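import Mathlib
import Summits.Ventures.LatticeQCDFlow.TrivializingMaps.SlotTensor

/-!
# The tensor shift of joint Casimir modes (THEORY-1 §19.2 (E4)–(E5) ⇒ THEOREM T (T3), file (5c-i))

HONEST FRAMING. Exact (Metropolis-corrected) sampling algorithms for lattice gauge theory; figures of
merit are autocorrelation/cost numbers at stated couplings and volumes; no continuum-physics claim.
This file is finite-dimensional linear algebra; no physics.

When a plaquette system `Q = (σ₁, lnk₁, pol₁)` is tensored onto an old system `S = (σ₂, lnk₂, pol₂)`, the
per-link slot Casimir of the sum system at a link `e` is the abstract Casimir of the family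
`a ↦ Y a + Z a`, `Y a = T_a^{Q,e} ⊗ 1`, `Z a = 1 ⊗ T_a^{S,e}` (`genCLM_sum_eq`).  `Z a` is skew, commutes with
`Y a`, and `C_Z = 1 ⊗ C^{S,e}` (`casimir_liftR`) commutes with every joint projection of the sum system
(`jointProj_comm_toE_liftR_casimirM`).  Hence (`CasimirGrading.eigen_shift`), for `w` in the old joint mode `m`
and any joint mode `m'` of the sum system meeting `y₁ ⊗ w`:

  `|m'_e - m_e| ≤ τ_e² + 2 τ_e √(m_e)`,  `τ_e = ∑ₐ ‖T_a^{Q,e}‖`  (`mode_shift`),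

where `τ_e` is computed on the FIXED plaquette space (`norm_toE_liftL_le`: `‖A ⊗ 1‖ ≤ ‖A‖`), so it does
not depend on the size of the old system; in particular `m'_e = m_e` at links the plaquette does not
touch (`mode_eq_of_forall_ne`).  With `CasimirGrading.sqrt_shift` this is the `local_on` / `local_off` /
`tw_le` input (T3) of the transfer theorem.  No irreducibility, highest weights or Clebsch–Gordan series.
[ours (bookkeeping); every ingredient folklore]
-/

noncomputable section

namespace Summit.Ventures.LatticeQCDFlow.TrivializingMaps.TensorShift

open scoped ComplexConjugate Matrix InnerProductSpace
open Finset
open Literature.MathematicalPhysics.QuantumFieldTheory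
open Literature.MathematicalPhysics.QuantumFieldTheory.Luscher2010
open SlotRepresentation SlotCasimir SlotHilbert JointGrading CasimirGrading SlotTensor

variable {n : ℕ} {σ₁ σ₂ : Type*} {E : Type*}

/-! ## 1. Adjoints and negation of lifted matrices -/

section Lifts
variable [Fintype σ₁] [Fintype σ₂]

omit [Fintype σ₁] in
/-- `(A ⊗ 1)ᴴ = Aᴴ ⊗ 1`. [folklore] -/
theorem liftL_conjTranspose (A : Matrix (σ₁ → Fin n) (σ₁ → Fin n) ℂ) :
    (liftL (σ₂ := σ₂) A)ᴴ = liftL (σ₂ := σ₂) Aᴴ := by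
  ext I J
  rw [Matrix.conjTranspose_apply, liftL_apply, liftL_apply, Matrix.conjTranspose_apply, star_mul',
    Matrix.one_apply, Matrix.one_apply]
  by_cases h : I ∘ Sum.inr = J ∘ Sum.inr
  · simp [h]
  · simp [h, Ne.symm h]

omit [Fintype σ₂] in
/-- `(1 ⊗ B)ᴴ = 1 ⊗ Bᴴ`. [folklore] -/
theorem liftR_conjTranspose (B : Matrix (σ₂ → Fin n) (σ₂ → Fin n) ℂ) :
    (liftR (σ₁ := σ₁) B)ᴴ = liftR (σ₁ := σ₁) Bᴴ := by
  ext I J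
  rw [Matrix.conjTranspose_apply, liftR_apply, liftR_apply, Matrix.conjTranspose_apply, star_mul',
    Matrix.one_apply, Matrix.one_apply]
  by_cases h : I ∘ Sum.inl = J ∘ Sum.inl
  · simp [h]
  · simp [h, Ne.symm h]

omit [Fintype σ₂] in
/-- `1 ⊗ (-B) = -(1 ⊗ B)`. [folklore] -/
theorem liftR_neg (B : Matrix (σ₂ → Fin n) (σ₂ → Fin n) ℂ) :
    liftR (σ₁ := σ₁) (-B) = -liftR (σ₁ := σ₁) B := by
  ext I J; simp [liftR_apply]

omit [Fintype σ₁] in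
/-- `(-A) ⊗ 1 = -(A ⊗ 1)`. [folklore] -/
theorem liftL_neg (A : Matrix (σ₁ → Fin n) (σ₁ → Fin n) ℂ) :
    liftL (σ₂ := σ₂) (-A) = -liftL (σ₂ := σ₂) A := by
  ext I J; simp [liftL_apply]

/-- `toE` is additive. [folklore] -/
theorem toE_add {σ : Type*} [Fintype σ] [DecidableEq σ] (A A' : Matrix (σ → Fin n) (σ → Fin n) ℂ) :
    toE (A + A') = toE A + toE A' := by
  unfold toE; exact map_add _ A A'

/-- `toE 0 = 0`. [folklore] -/
theorem toE_zero {σ : Type*} [Fintype σ] [DecidableEq σ] :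
    toE (0 : Matrix (σ → Fin n) (σ → Fin n) ℂ) = 0 := by
  unfold toE; exact map_zero _

end Lifts

/-! ## 2. `‖A ⊗ 1‖ ≤ ‖A‖`: slicing -/

section Slice
variable [Fintype σ₁] [Fintype σ₂] [DecidableEq σ₁] [DecidableEq σ₂]

/-- The `I₂`-slice of a vector of the sum space: `(slice v I₂)_{I₁} = v_{(I₁,I₂)}`. [folklore] -/
def slice (v : SlotSpace (σ₁ ⊕ σ₂) n) (I₂ : σ₂ → Fin n) : SlotSpace σ₁ n :=
  WithLp.toLp 2 fun I₁ => WithLp.ofLp v (Sum.elim I₁ I₂)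

/-- Entries of a slice. [folklore] -/
@[simp] theorem ofLp_slice_apply (v : SlotSpace (σ₁ ⊕ σ₂) n) (I₂ : σ₂ → Fin n) (I₁ : σ₁ → Fin n) :
    WithLp.ofLp (slice v I₂) I₁ = WithLp.ofLp v (Sum.elim I₁ I₂) := rfl

/-- `‖v‖² = ∑_I |v_I|²` in `WithLp.ofLp` form. [folklore] -/
theorem norm_sq_eq_sum {σ : Type*} [Fintype σ] [DecidableEq σ] (v : SlotSpace σ n) :
    ‖v‖ ^ 2 = ∑ I, ‖WithLp.ofLp v I‖ ^ 2 := by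
  rw [← inner_self_eq_norm_sq (𝕜 := ℂ) v, PiLp.inner_apply, map_sum]
  refine Finset.sum_congr rfl fun I _ => ?_
  rw [inner_self_eq_norm_sq (𝕜 := ℂ)]

/-- `‖v‖² = ∑_{I₂} ‖slice v I₂‖²`. [folklore] -/
theorem norm_sq_eq_sum_slice (v : SlotSpace (σ₁ ⊕ σ₂) n) : ‖v‖ ^ 2 = ∑ I₂, ‖slice v I₂‖ ^ 2 := by
  rw [norm_sq_eq_sum, sum_sumArrow (fun I => ‖WithLp.ofLp v I‖ ^ 2), Finset.sum_comm]
  refine Finset.sum_congr rfl fun I₂ _ => ?_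
  rw [norm_sq_eq_sum]; rfl

/-- `A ⊗ 1` acts slice-wise: `((A ⊗ 1) v)_{(I₁,I₂)} = (A · slice v I₂)_{I₁}`. [folklore] -/
theorem ofLp_toE_liftL_apply (A : Matrix (σ₁ → Fin n) (σ₁ → Fin n) ℂ) (v : SlotSpace (σ₁ ⊕ σ₂) n)
    (I₁ : σ₁ → Fin n) (I₂ : σ₂ → Fin n) :
    WithLp.ofLp (toE (liftL (σ₂ := σ₂) A) v) (Sum.elim I₁ I₂) = WithLp.ofLp (toE A (slice v I₂)) I₁ := by
  rw [Matrix.ofLp_toEuclideanCLM, Matrix.ofLp_toEuclideanCLM, Matrix.mulVec, dotProduct, sum_sumArrow,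
    Matrix.mulVec, dotProduct]
  refine Finset.sum_congr rfl fun J₁ _ => ?_
  simp only [liftL_apply, elim_comp_inl', elim_comp_inr', Matrix.one_apply, mul_ite, mul_one, mul_zero,
    ite_mul, zero_mul, Finset.sum_ite_eq, Finset.mem_univ, if_true, ofLp_slice_apply]

/-- Slices of `(A ⊗ 1) v` are `A` applied to slices. [folklore] -/
theorem slice_toE_liftL (A : Matrix (σ₁ → Fin n) (σ₁ → Fin n) ℂ) (v : SlotSpace (σ₁ ⊕ σ₂) n)
    (I₂ : σ₂ → Fin n) : slice (toE (liftL (σ₂ := σ₂) A) v) I₂ = toE A (slice v I₂) := by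
  apply (WithLp.ofLp_injective 2).eq_iff.1
  funext I₁
  rw [ofLp_slice_apply, ofLp_toE_liftL_apply]

/-- **`‖A ⊗ 1‖ ≤ ‖A‖`**: the operator norm of a plaquette generator lifted to the sum space does not
depend on the size of the old system. [folklore] -/
theorem norm_toE_liftL_le (A : Matrix (σ₁ → Fin n) (σ₁ → Fin n) ℂ) :
    ‖toE (liftL (σ₂ := σ₂) A)‖ ≤ ‖toE A‖ := by
  refine ContinuousLinearMap.opNorm_le_bound _ (norm_nonneg _) fun v => ?_
  have h : ‖toE (liftL (σ₂ := σ₂) A) v‖ ^ 2 ≤ (‖toE A‖ * ‖v‖) ^ 2 := by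
    rw [norm_sq_eq_sum_slice, mul_pow, norm_sq_eq_sum_slice v, Finset.mul_sum]
    refine Finset.sum_le_sum fun I₂ _ => ?_
    rw [slice_toE_liftL, ← mul_pow]
    exact pow_le_pow_left₀ (norm_nonneg _) (ContinuousLinearMap.le_opNorm _ _) 2
  exact (pow_le_pow_iff_left₀ (norm_nonneg _) (by positivity) two_ne_zero).1 h

end Slice

/-! ## 3. The sum system at one link: `Y ⊗ 1 + 1 ⊗ Z` -/

section Shift
variable [Fintype σ₁] [Fintype σ₂] [DecidableEq σ₁] [DecidableEq σ₂] [DecidableEq E]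
variable (lnk₁ : σ₁ → E) (pol₁ : σ₁ → Bool) (lnk₂ : σ₂ → E) (pol₂ : σ₂ → Bool) (B : SuBasis n)

/-- The lifted plaquette generators `Y a = T_a^{Q,e} ⊗ 1`. [ours] -/
def genL (e : E) (a : B.ι) : SlotSpace (σ₁ ⊕ σ₂) n →L[ℂ] SlotSpace (σ₁ ⊕ σ₂) n :=
  toE (liftL (σ₂ := σ₂) (slotGen lnk₁ pol₁ e (B.T a)))

/-- The lifted old generators `Z a = 1 ⊗ T_a^{S,e}`. [ours] -/
def genR (e : E) (a : B.ι) : SlotSpace (σ₁ ⊕ σ₂) n →L[ℂ] SlotSpace (σ₁ ⊕ σ₂) n :=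
  toE (liftR (σ₁ := σ₁) (slotGen lnk₂ pol₂ e (B.T a)))

/-- The generators of the sum system split: `T_a^{Q⊕S,e} = Y a + Z a`. [ours] -/
theorem genCLM_sum_eq (e : E) (a : B.ι) :
    genCLM (Sum.elim lnk₁ lnk₂) (Sum.elim pol₁ pol₂) e (B.T a)
      = genL (σ₂ := σ₂) lnk₁ pol₁ B e a + genR (σ₁ := σ₁) lnk₂ pol₂ B e a := by
  rw [genCLM, slotGen_sum, genL, genR, toE_add]

/-- `Z a` is skew-adjoint. [ours] -/
theorem adjoint_genR (e : E) (a : B.ι) :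
    ContinuousLinearMap.adjoint (genR (σ₁ := σ₁) lnk₂ pol₂ B e a) = -genR (σ₁ := σ₁) lnk₂ pol₂ B e a := by
  rw [genR, ← toE_conjTranspose, liftR_conjTranspose, slotGen_conjTranspose_of_skew lnk₂ pol₂ e (skew_T B a),
    liftR_neg, toE_neg]

/-- `Y a` and `Z a` commute (they act on different tensor factors). [ours] -/
theorem genL_comm_genR (e : E) (a : B.ι) :
    genL (σ₂ := σ₂) lnk₁ pol₁ B e a ∘L genR (σ₁ := σ₁) lnk₂ pol₂ B e a
      = genR (σ₁ := σ₁) lnk₂ pol₂ B e a ∘L genL (σ₂ := σ₂) lnk₁ pol₁ B e a := by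
  rw [genL, genR, ← toE_mul, ← toE_mul, liftL_mul_liftR]

/-- `∑ₐ (T_a^{S,e})ᴴ T_a^{S,e} = C^{S,e}`. [ours] -/
theorem sum_conjTranspose_mul_slotGen {σ : Type*} [Fintype σ] [DecidableEq σ] (lnk : σ → E)
    (pol : σ → Bool) (e : E) :
    ∑ a, (slotGen lnk pol e (B.T a))ᴴ * slotGen lnk pol e (B.T a) = casimirM B lnk pol e := by
  rw [casimirM, ← Finset.sum_neg_distrib]
  refine Finset.sum_congr rfl fun a _ => ?_
  rw [slotGen_conjTranspose_of_skew lnk pol e (skew_T B a), neg_mul]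

/-- **`C_Z = 1 ⊗ C^{S,e}`**: the abstract Casimir of the lifted old generators. [ours] -/
theorem casimir_genR (e : E) :
    casimir (genR (σ₁ := σ₁) lnk₂ pol₂ B e) = toE (liftR (σ₁ := σ₁) (casimirM B lnk₂ pol₂ e)) := by
  unfold casimir
  have h : ∀ a, ContinuousLinearMap.adjoint (genR (σ₁ := σ₁) lnk₂ pol₂ B e a) ∘L genR (σ₁ := σ₁) lnk₂ pol₂ B e a
      = toE (liftR (σ₁ := σ₁) ((slotGen lnk₂ pol₂ e (B.T a))ᴴ * slotGen lnk₂ pol₂ e (B.T a))) := fun a => by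
    rw [genR, ← toE_conjTranspose, ← toE_mul, liftR_conjTranspose, liftR_mul]
  simp_rw [h]
  rw [← toE_sum, ← liftR_sum, sum_conjTranspose_mul_slotGen]

/-- `1 ⊗ C^{S,e}` commutes with every slot Casimir of the sum system. [ours] -/
theorem liftR_casimirM_comm (e e' : E) :
    Commute (liftR (σ₁ := σ₁) (casimirM B lnk₂ pol₂ e))
      (casimirM B (Sum.elim lnk₁ lnk₂) (Sum.elim pol₁ pol₂) e') := by
  have hS : casimirM B (Sum.elim lnk₁ lnk₂) (Sum.elim pol₁ pol₂) e'
      = -∑ a, (liftL (slotGen lnk₁ pol₁ e' (B.T a)) + liftR (slotGen lnk₂ pol₂ e' (B.T a)))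
          * (liftL (slotGen lnk₁ pol₁ e' (B.T a)) + liftR (slotGen lnk₂ pol₂ e' (B.T a))) := by
    simp only [casimirM, slotGen_sum]
  rw [hS]
  refine Commute.neg_right (Commute.sum_right _ _ _ fun a _ => ?_)
  have h1 : Commute (liftR (σ₁ := σ₁) (casimirM B lnk₂ pol₂ e))
      (liftL (σ₂ := σ₂) (slotGen lnk₁ pol₁ e' (B.T a))) :=
    (liftL_mul_liftR (slotGen lnk₁ pol₁ e' (B.T a)) (casimirM B lnk₂ pol₂ e)).symm
  have h2 : Commute (liftR (σ₁ := σ₁) (casimirM B lnk₂ pol₂ e))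
      (liftR (σ₁ := σ₁) (slotGen lnk₂ pol₂ e' (B.T a))) := by
    show liftR (σ₁ := σ₁) _ * liftR (σ₁ := σ₁) _ = liftR (σ₁ := σ₁) _ * liftR (σ₁ := σ₁) _
    rw [← liftR_mul, ← liftR_mul, casimirM_comm_slotGen B lnk₂ pol₂ e e' (B.mem a)]
  exact (h1.add_right h2).mul_right (h1.add_right h2)

/-- `1 ⊗ C^{S,e}` commutes with every joint projection of the sum system. [ours] -/
theorem jointProj_comm_toE_liftR_casimirM (e : E)
    (m' : Modes (casimirFamily (Sum.elim lnk₁ lnk₂) (Sum.elim pol₁ pol₂) B)) :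
    jointProj (casimirFamily (Sum.elim lnk₁ lnk₂) (Sum.elim pol₁ pol₂) B) m'
        ∘L toE (liftR (σ₁ := σ₁) (casimirM B lnk₂ pol₂ e))
      = toE (liftR (σ₁ := σ₁) (casimirM B lnk₂ pol₂ e))
        ∘L jointProj (casimirFamily (Sum.elim lnk₁ lnk₂) (Sum.elim pol₁ pol₂) B) m' :=
  jointProj_comm _ (fun e' => isSelfAdjoint_casimirCLM _ _ B e')
    (fun e' => toE_comm (liftR_casimirM_comm lnk₁ pol₁ lnk₂ pol₂ B e e')) m'

/-! ## 4. The mode shift -/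

/-- The **plaquette generator norm at a link**: `τ_e = ∑ₐ ‖T_a^{Q,e}‖` on the FIXED plaquette space.
[ours] -/
def genNorm (e : E) : ℝ := ∑ a, ‖genCLM lnk₁ pol₁ e (B.T a)‖

/-- `τ_e ≥ 0`. [ours] -/
theorem genNorm_nonneg (e : E) : 0 ≤ genNorm lnk₁ pol₁ B e := Finset.sum_nonneg fun _ _ => norm_nonneg _

/-- `τ_e = 0` at a link the plaquette system does not touch. [ours] -/
theorem genNorm_eq_zero_of_forall_ne {e : E} (he : ∀ s, lnk₁ s ≠ e) : genNorm lnk₁ pol₁ B e = 0 := by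
  refine Finset.sum_eq_zero fun a _ => ?_
  have h0 : slotGen lnk₁ pol₁ e (B.T a) = 0 := by
    rw [slotGen]; exact Finset.sum_eq_zero fun s _ => if_neg (he s)
  rw [genCLM, h0, toE_zero, norm_zero]

/-- `‖Y a‖ ≤ ‖T_a^{Q,e}‖`. [ours] -/
theorem norm_genL_le (e : E) (a : B.ι) :
    ‖genL (σ₂ := σ₂) lnk₁ pol₁ B e a‖ ≤ ‖genCLM lnk₁ pol₁ e (B.T a)‖ :=
  norm_toE_liftL_le _

/-- `‖C_Y‖ ≤ τ_e²`. [ours] -/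
theorem norm_casimir_genL_le (e : E) :
    ‖casimir (genL (σ₂ := σ₂) lnk₁ pol₁ B e)‖ ≤ genNorm lnk₁ pol₁ B e ^ 2 := by
  unfold casimir
  refine (norm_sum_le _ _).trans ?_
  rw [genNorm, sq, Finset.sum_mul]
  refine Finset.sum_le_sum fun a _ => ?_
  refine (ContinuousLinearMap.opNorm_comp_le _ _).trans ?_
  rw [LinearIsometryEquiv.norm_map]
  exact mul_le_mul (norm_genL_le (σ₂ := σ₂) lnk₁ pol₁ B e a)
    ((norm_genL_le (σ₂ := σ₂) lnk₁ pol₁ B e a).trans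
      (Finset.single_le_sum (fun b _ => norm_nonneg (genCLM lnk₁ pol₁ e (B.T b))) (Finset.mem_univ a)))
    (norm_nonneg _) (norm_nonneg _)

/-- `∑ₐ ‖Y a‖ ≤ τ_e`. [ours] -/
theorem sum_norm_genL_le (e : E) :
    ∑ a, ‖genL (σ₂ := σ₂) lnk₁ pol₁ B e a‖ ≤ genNorm lnk₁ pol₁ B e :=
  Finset.sum_le_sum fun a _ => norm_genL_le (σ₂ := σ₂) lnk₁ pol₁ B e a

/-- **The mode shift (E4).** Let `w` lie in the joint mode `m` of the old system `S` and let `m'` be a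
joint mode of the sum system `Q ⊕ S` whose projection meets `y₁ ⊗ w`.  Then at every link `e`,
`|m'_e - m_e| ≤ τ_e² + 2 τ_e √(m_e)` with `τ_e = ∑ₐ ‖T_a^{Q,e}‖` computed on the plaquette space alone.
[ours] -/
theorem mode_shift (e : E) (m : Modes (casimirFamily lnk₂ pol₂ B)) {w : SlotSpace σ₂ n}
    (hw : w ∈ jointSpace (casimirFamily lnk₂ pol₂ B) m) (y₁ : SlotSpace σ₁ n)
    (m' : Modes (casimirFamily (Sum.elim lnk₁ lnk₂) (Sum.elim pol₁ pol₂) B))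
    (hu : jointProj (casimirFamily (Sum.elim lnk₁ lnk₂) (Sum.elim pol₁ pol₂) B) m' (tens y₁ w) ≠ 0) :
    |(m' e : ℂ).re - (m e : ℂ).re|
      ≤ genNorm lnk₁ pol₁ B e ^ 2 + 2 * genNorm lnk₁ pol₁ B e * Real.sqrt (m e : ℂ).re := by
  set P := jointProj (casimirFamily (Sum.elim lnk₁ lnk₂) (Sum.elim pol₁ pol₂) B) m' with hP
  -- `C_Z u = m_e u`
  have hZw : toE (casimirM B lnk₂ pol₂ e) w = (((m e : ℂ).re : ℝ) : ℂ) • w := by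
    rw [← mode_eq_re _ (fun e' => isSelfAdjoint_casimirCLM lnk₂ pol₂ B e') m e]
    exact (mem_jointSpace_iff.1 hw) e
  have huZ : casimir (genR (σ₁ := σ₁) lnk₂ pol₂ B e) (P (tens y₁ w))
      = (((m e : ℂ).re : ℝ) : ℂ) • P (tens y₁ w) := by
    have hc := congrArg (fun F : SlotSpace (σ₁ ⊕ σ₂) n →L[ℂ] SlotSpace (σ₁ ⊕ σ₂) n => F (tens y₁ w))
      (jointProj_comm_toE_liftR_casimirM lnk₁ pol₁ lnk₂ pol₂ B e m')
    simp only [ContinuousLinearMap.comp_apply] at hc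
    rw [casimir_genR, hP, ← hc, toE_liftR_tens, hZw, tens_smul_right, map_smul]
  -- `C_{Y+Z} u = m'_e u`
  have hu' : casimir (fun a => genL (σ₂ := σ₂) lnk₁ pol₁ B e a + genR (σ₁ := σ₁) lnk₂ pol₂ B e a) (P (tens y₁ w))
      = (((m' e : ℂ).re : ℝ) : ℂ) • P (tens y₁ w) := by
    have hC : casimir (fun a => genL (σ₂ := σ₂) lnk₁ pol₁ B e a + genR (σ₁ := σ₁) lnk₂ pol₂ B e a)
        = casimirCLM (Sum.elim lnk₁ lnk₂) (Sum.elim pol₁ pol₂) B e := by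
      rw [casimirCLM_eq_casimir]
      congr 1; funext a; exact (genCLM_sum_eq lnk₁ pol₁ lnk₂ pol₂ B e a).symm
    rw [hC, hP, casimirCLM_jointProj]
  have h := eigen_shift (genL (σ₂ := σ₂) lnk₁ pol₁ B e) (genR (σ₁ := σ₁) lnk₂ pol₂ B e)
    (adjoint_genR (σ₁ := σ₁) lnk₂ pol₂ B e) (genL_comm_genR lnk₁ pol₁ lnk₂ pol₂ B e) hu huZ hu'
  refine h.trans (add_le_add (norm_casimir_genL_le (σ₂ := σ₂) lnk₁ pol₁ B e) ?_)
  exact mul_le_mul_of_nonneg_right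
    (mul_le_mul_of_nonneg_left (sum_norm_genL_le (σ₂ := σ₂) lnk₁ pol₁ B e) two_pos.le)
    (Real.sqrt_nonneg _)

/-- **Off the plaquette the mode does not move (T3a)**: if `Q` has no slot on `e` then `m'_e = m_e`.
[ours] -/
theorem mode_eq_of_forall_ne {e : E} (he : ∀ s, lnk₁ s ≠ e) (m : Modes (casimirFamily lnk₂ pol₂ B))
    {w : SlotSpace σ₂ n} (hw : w ∈ jointSpace (casimirFamily lnk₂ pol₂ B) m) (y₁ : SlotSpace σ₁ n)
    (m' : Modes (casimirFamily (Sum.elim lnk₁ lnk₂) (Sum.elim pol₁ pol₂) B))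
    (hu : jointProj (casimirFamily (Sum.elim lnk₁ lnk₂) (Sum.elim pol₁ pol₂) B) m' (tens y₁ w) ≠ 0) :
    (m' e : ℂ).re = (m e : ℂ).re := by
  have h := mode_shift lnk₁ pol₁ lnk₂ pol₂ B e m hw y₁ m' hu
  rw [genNorm_eq_zero_of_forall_ne lnk₁ pol₁ B he] at h
  have h0 : |(m' e : ℂ).re - (m e : ℂ).re| ≤ 0 := by simpa using h
  exact sub_eq_zero.1 (abs_nonpos_iff.1 h0)

/-- **The weight shift on the plaquette (T3b/T3c)**: `√(m'_e) ≤ √(m_e) + σ_e` and `√(m_e) ≤ √(m'_e) + σ_e`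
with `σ_e = shiftConst τ_e τ_e² = (1 + √2) τ_e`. [ours] -/
theorem sqrt_mode_shift (e : E) (m : Modes (casimirFamily lnk₂ pol₂ B)) {w : SlotSpace σ₂ n}
    (hw : w ∈ jointSpace (casimirFamily lnk₂ pol₂ B) m) (y₁ : SlotSpace σ₁ n)
    (m' : Modes (casimirFamily (Sum.elim lnk₁ lnk₂) (Sum.elim pol₁ pol₂) B))
    (hu : jointProj (casimirFamily (Sum.elim lnk₁ lnk₂) (Sum.elim pol₁ pol₂) B) m' (tens y₁ w) ≠ 0) :
    Real.sqrt (m' e : ℂ).re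
        ≤ Real.sqrt (m e : ℂ).re + shiftConst (genNorm lnk₁ pol₁ B e) (genNorm lnk₁ pol₁ B e ^ 2) ∧
      Real.sqrt (m e : ℂ).re
        ≤ Real.sqrt (m' e : ℂ).re + shiftConst (genNorm lnk₁ pol₁ B e) (genNorm lnk₁ pol₁ B e ^ 2) := by
  refine sqrt_shift (slotMode_nonneg lnk₂ pol₂ B m e) (genNorm_nonneg lnk₁ pol₁ B e) (sq_nonneg _) ?_
  have h := mode_shift lnk₁ pol₁ lnk₂ pol₂ B e m hw y₁ m' hu
  linarith [h]

end Shift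

end Summit.Ventures.LatticeQCDFlow.TrivializingMaps.TensorShift
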